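import Summits.CriticalPhenomena.SAWScalingLimit.Theorems.SAWDevelopingMapHexConjectureArchTailSummed
import Literature.Probability.RandomPlanarGeometry.HexSAWTriangle
import HarnessLib

/-!
# Crux `HexConjecture` (stmt-CriticalPhenomena-0808), line `root-locality-replaces-loewner`:
the chart preimage of the Glazman–Manolescu triangle `T_L` at a vertical floor mid-edge

Landing target:
`Summits/CriticalPhenomena/SAWScalingLimit/Theorems/SAWDevelopingMapHexConjectureTriangleChart.lean`
(`--supports stmt-CriticalPhenomena-0808`; registered stubs `stub_triChartGeometry` and
`stub_triChartSubsetHalfStrip` of the line).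

The lever of the line is an "arch aspect bound"; its far side (the `x_c`-mass of the half-plane
arches `s_x → t_d` leaving the half-disc of radius `R` about `mid s_x`) is bounded by the
Glazman–Manolescu / Krachun–Panagiotis triangle tail `1/cos(3π/8) − A^Δ(L)`, by the template of the
landed `farArchMass_offsetSum_le` (`…HexConjectureArchTailSummed.lean`) with the chart preimage
`T_x(L) := Φ_x⁻¹(V(T_L))` of the triangle `T_L` of GlazmanManolescu2019 §4.1
(`HV.triV L = {(x₀, x₁, b) : 0 ≤ x₁, -L ≤ x₀, x₀ + x₁ + b ≤ L}`, `HexSAWTriangle.lean`) in place of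
the inner Duminil-Copin–Smirnov strip `S_x(N) = Φ_x⁻¹(V(S_{N+1,N+1}))` (DuminilCopinSmirnov2012 §3),
`Φ_x = shift(-x) ∘ hvIso` the standard chart at the cell `x` and `s_x = {(x - e₁, 1), (x, 0)}` the
vertical floor mid-edge.  This file is the geometry of that preimage:

* `triChart_mem_iff`, `triChart_map`: membership in `T_x(L)` and `Φ_x(T_x(L)) = V(T_L)`;
* `triChart_geometry` / **`stub_triChartGeometry`**: every vertex of `T_x(L)` lies in the rows
  `≥ x₁` and within Euclidean distance `3L + 2` of `mid s_x` (copy of `halfStrip_geometry`,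
  `…HalfPlaneArchTightnessStrips.lean`, with `mem_triV_iff` for `mem_stripV_iff`);
* `triChart_subset_halfStrip` / **`stub_triChartSubsetHalfStrip`**: `T_x(L) ⊆ S_x(N)` as soon as
  `2L ≤ N` (`triV_subset_stripV`: `T_L` is inscribed in `S_{2L+1, L}`).
-/

noncomputable section

open scoped BigOperators Topology Classical
open Literature.Probability.LatticeModels (HexVertex hexGraph hexCenter Site)
open Literature.Probability.RandomPlanarGeometry Literature.Probability.RandomPlanarGeometry.SAW
  Literature.Probability.RandomPlanarGeometry.SAW.HV
open Literature.Probability.Percolation (hexCenter_im hexCenter_re)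
open Summit.CriticalPhenomena.SAWScalingLimit.Theorems.ObservableToSLE.FloorRatio

namespace Summit.CriticalPhenomena.SAWScalingLimit.Theorems.HexConjecture.RootLocality

/-! ### The chart preimage `T_x(L)` of the triangle `T_L` -/

/-- Membership in the triangle `T_x(L) = Φ_x⁻¹(V(T_L))`, `Φ_x` the standard chart at the cell `x`.
[cite: GlazmanManolescu2019, §4.1 (T_L)] -/
theorem triChart_mem_iff (x : Site 2) (L : ℕ) (w : HexVertex) :
    w ∈ (triV L).map (hvIso.trans (shift (-(x 0)) (-(x 1)))).symm.toEquiv.toEmbedding ↔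
      (hvIso.trans (shift (-(x 0)) (-(x 1)))) w ∈ triV L := by
  rw [Finset.mem_map_equiv]
  exact Iff.rfl

/-- The chart maps the triangle `T_x(L)` onto `V(T_L)`. [cite: GlazmanManolescu2019, §4.1 (T_L)] -/
theorem triChart_map (x : Site 2) (L : ℕ) :
    ((triV L).map (hvIso.trans (shift (-(x 0)) (-(x 1)))).symm.toEquiv.toEmbedding).map
        (hvIso.trans (shift (-(x 0)) (-(x 1)))).toEquiv.toEmbedding = triV L := by
  ext v
  rw [Finset.mem_map_equiv, Finset.mem_map_equiv]
  exact iff_of_eq (congrArg (· ∈ _) ((hvIso.trans (shift (-(x 0)) (-(x 1)))).apply_symm_apply v))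

/-- **Geometry of the triangle preimage.**  Every vertex of `T_x(L)` lies in the rows `≥ x₁` and
within Euclidean distance `3L + 2` of `mid s_x`: in chart coordinates `(a, b, bit)` of a vertex
(`0 ≤ b`, `-L ≤ a`, `a + b + bit ≤ L`) the real part of `c_w - mid s_x` is `a + b/2 + i/2 ∈ [-L, L + 1]`
and its imaginary part is `(b + (i+1)/3) · (√3/2) ∈ [0, 2L + 1]`.
[cite: GlazmanManolescu2019, §4.1 (T_L)] -/
theorem triChart_geometry {x : Site 2} {L : ℕ} {w : HexVertex}
    (hw : w ∈ (triV L).map (hvIso.trans (shift (-(x 0)) (-(x 1)))).symm.toEquiv.toEmbedding) :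
    x 1 ≤ w.1 1 ∧
      dist (hexCenter w) (hexMidpoint s((x - Pi.single 1 1, 1), (x, 0))) ≤ 3 * L + 2 := by
  -- adapted from `halfStrip_geometry` (…HalfPlaneArchTightnessStrips.lean)
  obtain ⟨z, i⟩ := w
  rw [triChart_mem_iff, floorChart_apply, mem_triV_iff] at hw
  have hint : 0 ≤ z 1 - x 1 ∧ -(L : ℤ) ≤ z 0 - x 0 ∧ z 0 - x 0 + (z 1 - x 1) ≤ L := by
    fin_cases i <;> simp [bit] at hw <;> omega
  obtain ⟨h1, h3, h5⟩ := hint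
  refine ⟨by simpa using h1, ?_⟩
  have r1 : (x 1 : ℝ) ≤ z 1 := by exact_mod_cast (by omega : x 1 ≤ z 1)
  have r3 : (x 0 : ℝ) - L ≤ z 0 := by exact_mod_cast (by omega : x 0 - (L : ℤ) ≤ z 0)
  have r5 : (z 0 : ℝ) + z 1 ≤ x 0 + x 1 + L := by
    exact_mod_cast (by omega : z 0 + z 1 ≤ x 0 + x 1 + (L : ℤ))
  have hi : (0 : ℝ) ≤ ((i : ℕ) : ℝ) ∧ ((i : ℕ) : ℝ) ≤ 1 := by fin_cases i <;> simp
  have hc0 : (0 : ℝ) < Real.sqrt 3 / 2 := by positivity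
  have hc1 : Real.sqrt 3 / 2 ≤ 1 := by
    rw [div_le_one (by norm_num : (0 : ℝ) < 2)]
    have h4' : Real.sqrt 4 = 2 := by
      rw [show (4 : ℝ) = 2 ^ 2 by norm_num, Real.sqrt_sq (by norm_num)]
    rw [← h4']
    exact Real.sqrt_le_sqrt (by norm_num)
  rw [Complex.dist_eq]
  refine (Complex.norm_le_abs_re_add_abs_im _).trans ?_
  rw [Complex.sub_re, Complex.sub_im, hexCenter_re, hexCenter_im, re_hexMidpoint_floorEdge,
    im_hexMidpoint_floorEdge]
  have hre : |(z 0 : ℝ) + (z 1 : ℝ) / 2 + (((i : ℕ) : ℝ) + 1) / 2 - ((x 0 : ℝ) + (x 1 : ℝ) / 2 + 1 / 2)|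
      ≤ L + 1 := by
    rw [abs_le]; constructor <;> linarith [hi.1, hi.2]
  have him : |((z 1 : ℝ) + (((i : ℕ) : ℝ) + 1) / 3) * (Real.sqrt 3 / 2) - (x 1 : ℝ) * (Real.sqrt 3 / 2)|
      ≤ 2 * L + 1 := by
    have e : ((z 1 : ℝ) + (((i : ℕ) : ℝ) + 1) / 3) * (Real.sqrt 3 / 2) - (x 1 : ℝ) * (Real.sqrt 3 / 2)
        = ((z 1 : ℝ) - x 1 + (((i : ℕ) : ℝ) + 1) / 3) * (Real.sqrt 3 / 2) := by ring
    rw [e, abs_of_nonneg (mul_nonneg (by linarith [hi.1]) hc0.le)]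
    calc ((z 1 : ℝ) - x 1 + (((i : ℕ) : ℝ) + 1) / 3) * (Real.sqrt 3 / 2)
        ≤ (2 * (L : ℝ) + 1) * 1 :=
          mul_le_mul (by linarith [hi.2]) hc1 hc0.le (by positivity)
      _ = 2 * L + 1 := mul_one _
  linarith

/-- **The triangle preimage lies in the half-strip**: `T_x(L) ⊆ S_x(N) = Φ_x⁻¹(V(S_{N+1,N+1}))` as
soon as `2L ≤ N` (`T_L` is inscribed in the strip `S_{2L+1, L}`).
[cite: GlazmanManolescu2019, §4.1 ("inscribe inside it an equilateral triangle")] -/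
theorem triChart_subset_halfStrip (x : Site 2) {L N : ℕ} (h : 2 * L ≤ N) :
    (triV L).map (hvIso.trans (shift (-(x 0)) (-(x 1)))).symm.toEquiv.toEmbedding ⊆
      (stripV (N + 1) (N + 1)).map
        (hvIso.trans (shift (-(x 0)) (-(x 1)))).symm.toEquiv.toEmbedding :=
  Finset.map_subset_map.2 (triV_subset_stripV (by omega) (by omega))

/-- **Registered sub-goal `stub_triChartGeometry`** (crux item stmt-CriticalPhenomena-0808, line
`root-locality-replaces-loewner`): every vertex of the chart preimage `T_x(L)` of the
Glazman–Manolescu triangle lies in the rows `≥ x₁` and within Euclidean distance `3L + 2` of the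
midpoint of the vertical floor mid-edge `s_x` (`triChart_geometry`).
[cite: GlazmanManolescu2019, §4.1 (T_L)] -/
theorem stub_triChartGeometry : ∀ (x : Literature.Probability.LatticeModels.Site 2) (L : ℕ)
    (w : Literature.Probability.LatticeModels.HexVertex),
    w ∈ (Literature.Probability.RandomPlanarGeometry.SAW.HV.triV L).map
      ((Literature.Probability.RandomPlanarGeometry.SAW.hvIso.trans
        (Literature.Probability.RandomPlanarGeometry.SAW.HV.shift (-(x 0)) (-(x 1)))).symm.toEquiv.toEmbedding) →
    x 1 ≤ w.1 1 ∧ dist (Literature.Probability.LatticeModels.hexCenter w)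
      (Literature.Probability.RandomPlanarGeometry.SAW.hexMidpoint s((x - Pi.single 1 1, 1), (x, 0))) ≤
        3 * L + 2 :=
  fun _ _ _ hw => triChart_geometry hw

/-- **Registered sub-goal `stub_triChartSubsetHalfStrip`** (crux item stmt-CriticalPhenomena-0808,
line `root-locality-replaces-loewner`): the chart preimage `T_x(L)` of the triangle lies in the
half-strip `S_x(N)` whenever `2L ≤ N` (`triChart_subset_halfStrip`).
[cite: GlazmanManolescu2019, §4.1 ("inscribe inside it an equilateral triangle")] -/
theorem stub_triChartSubsetHalfStrip : ∀ (x : Literature.Probability.LatticeModels.Site 2) (L N : ℕ),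
    2 * L ≤ N →
    (Literature.Probability.RandomPlanarGeometry.SAW.HV.triV L).map
      ((Literature.Probability.RandomPlanarGeometry.SAW.hvIso.trans
        (Literature.Probability.RandomPlanarGeometry.SAW.HV.shift (-(x 0)) (-(x 1)))).symm.toEquiv.toEmbedding) ⊆
    (Literature.Probability.RandomPlanarGeometry.SAW.HV.stripV (N + 1) (N + 1)).map
      ((Literature.Probability.RandomPlanarGeometry.SAW.hvIso.trans
        (Literature.Probability.RandomPlanarGeometry.SAW.HV.shift (-(x 0)) (-(x 1)))).symm.toEquiv.toEmbedding) :=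
  fun x _ _ h => triChart_subset_halfStrip x h

end Summit.CriticalPhenomena.SAWScalingLimit.Theorems.HexConjecture.RootLocality

end
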